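import Mathlib
import Summits.MatrixMultiplication.MatrixMultiplication.Theses.SnSubsetDichotomy

/-!
# `stub_bandRelocation` (line `mover-covering-amgm`, crux `SnSubsetDichotomy.JuntaBranch`,
# stmt-MatrixMultiplication-8304) — exit (b) is false without `Large`: the level-1 family

Companion of `stub_bandRelocation.lean` (level transfer / near-band regime / reduction to the deep
regimes).  The registered stub offers, next to an `ε`-super-neutral block `(I → L)` of `S` at an
out-of-band level `t`, the exit (b) "the partners pay on the spot":
`∃ J P` injective, `e^{c+1}|S||T||U|((n−t)!/n!)^{3/2} ≤ |S_I||T_J||U_P|` (joint gain at the block,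
cashed by `UmvirateDescent`).  This file shows that exit (b) is LOAD-BEARING on the largeness
hypothesis `(n!)^{3/2}e^{-c√n} ≤ |S||T||U|`: the stub with `Large` deleted and the conclusion
restricted to (b) is false (`bandRelocation_exitB_false_without_large`; `ε = 1/4`, `c = 1`, every
even `n ≥ max(2n₀, 4)`).

The witness is the level-1 fixed-point family in `S_{2m}` (`a = 0 < m`):
`S = Stab(a)`, `T = {(a x) : x < m} ∋ 1`, `U = {(a y) : y = a ∨ y ≥ m} ∋ 1` (all three
written inline as filtered/imaged `Finset`s).  It is a TPP triple (`tpp_swapFamily`: evaluate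
the relation at `a`), BOTH partners are inclusion-saturated w.r.t. `S` (`satMid_swapFamily`,
`satRight_swapFamily`: for `g ∉ T` resp. `U`, `y = g⁻¹ a` and the transposition `(a y) ∈ T ∪ U` give
a non-trivial solution of the TPP relation), `S` has the maximal level-1 bump `R_S(a→a) = n >
n^{3/4}` (level `1` lies below every band), and every partner atom with target `a` is a single
permutation (`card_atom_swapImage_le_one`), so `|S_a||T_j||U_p| ≤ |S| < e²|S||T||U|/n^{3/2}`
(`|T| = m`, `|U| ≥ m`, `n^{3/2} ≤ 2m²`).  Consequence for the line: at a LOW bump of `S`, TPP +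
saturation + the bump force no partner isotropy at `S`'s target; exit (b) must come from
near-extremal volume (here `|S||T||U| ≈ (n−1)!·n²/4 ≪ (n!)^{3/2}`).  Exit (a) does hold for this
family (`T` fixes `n − m` points, so it is super-neutral at every band level), consistently with the
stub; refuting (a) ∨ (b) without `Large` would need spread saturated partners of size
`≥ n^{(1/2−ε')t_hi}`, and with `Large` no family is known for any fixed `c` (the stub is irrefutable
today).
-/

open Literature.Combinatorics.Additive
open scoped Classical

set_option linter.dupNamespace false

namespace Summit.MatrixMultiplication.MatrixMultiplication.Theorems.JuntaBranch

/-! ## Exit (b) alone is false without `Large`: the level-1 fixed-point family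

`S = Stab(a)`, `T = {(a x) : x < m}` (`∋ 1 = (a a)`), `U = {(a y) : y = a ∨ y ≥ m}` in `S_n`,
`a = 0 < m ≤ n`: a TPP triple whose partners are inclusion-saturated w.r.t. `S`, with the maximal
level-1 bump `R_S(a→a) = n` of `S`, at which every partner atom with target `a` is a single
permutation (`|T ∩ U_{j→a}| ≤ 1`), so exit (b) — `e^{c+1}|S||T||U|·n^{-3/2} ≤ |S_a||T_j||U_p|` —
fails as soon as `e^{c+1}|T||U| > n^{3/2}` (`|T||U| ≈ n²/4`). -/

/-- Two distinct transpositions through `a` compose to a mover of `a`: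
`(a y)((a y') a) ∈ {y, y'} ∖ {a}` for `y ≠ y'`. [folklore] -/
theorem swap_swap_apply_ne {α : Type*} [DecidableEq α] (a y y' : α) (h : y ≠ y') :
    Equiv.swap a y (Equiv.swap a y' a) ≠ a ∧
      (Equiv.swap a y (Equiv.swap a y' a) = y ∨ Equiv.swap a y (Equiv.swap a y' a) = y') := by
  rw [Equiv.swap_apply_left, Equiv.swap_apply_def]
  split_ifs with h1 h2
  · exact ⟨fun e => h (e.trans h1.symm), Or.inl rfl⟩
  · exact absurd h2.symm h
  · exact ⟨h1, Or.inr rfl⟩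

/-- **TPP of the level-1 family.**  `(Stab(a), {(a x) : x < m}, {(a y) : y = a ∨ y ≥ m})` has the
triple product property when `a < m`: evaluating `s s'⁻¹ (a x)(a x')(a y)(a y') = 1` at `a`, the
`U`-part moves `a` into `{y ≥ m}` unless `y = y'` (and then nothing on the `T`-side or in `Stab(a)`
brings it back), and likewise the `T`-part unless `x = x'`. [folklore] -/
theorem tpp_swapFamily {n m : ℕ} (a : Fin n) (ha : (a : ℕ) < m) :
    TripleProductProperty ((Finset.univ.filter (fun σ : Equiv.Perm (Fin n) => σ a = a))) (((Finset.univ.filter (fun x : Fin n => (x : ℕ) < m)).image (Equiv.swap a))) (((Finset.univ.filter (fun x : Fin n => x = a ∨ m ≤ (x : ℕ))).image (Equiv.swap a))) := by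
  intro s hs s' hs' τ hτ τ' hτ' υ hυ υ' hυ' hrel
  simp only [Finset.mem_filter, Finset.mem_univ, true_and] at hs hs'
  simp only [Finset.mem_image, Finset.mem_filter, Finset.mem_univ,
    true_and] at hτ hτ' hυ hυ'
  obtain ⟨x, hx, rfl⟩ := hτ
  obtain ⟨x', hx', rfl⟩ := hτ'
  obtain ⟨y, hy, rfl⟩ := hυ
  obtain ⟨y', hy', rfl⟩ := hυ'
  simp only [Equiv.swap_inv] at hrel
  -- evaluate the relation at `a`
  have hv : Equiv.swap a x (Equiv.swap a x' (Equiv.swap a y (Equiv.swap a y' a))) = a := by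
    have h1 := congrArg (fun π : Equiv.Perm (Fin n) => π a) hrel
    simp only [Equiv.Perm.mul_apply, Equiv.Perm.one_apply] at h1
    have h2 : s'⁻¹ (Equiv.swap a x (Equiv.swap a x' (Equiv.swap a y (Equiv.swap a y' a)))) = a := by
      apply s.injective
      rw [h1, hs]
    rw [Equiv.Perm.inv_eq_iff_eq] at h2
    exact h2.trans hs'
  -- the `U`-side must cancel
  have hyy : y = y' := by
    by_contra hne
    obtain ⟨hw, hw'⟩ := swap_swap_apply_ne a y y' hne
    set w := Equiv.swap a y (Equiv.swap a y' a) with hw_def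
    have hmw : m ≤ (w : ℕ) := by
      rcases hw' with h | h <;> rw [h] at hw ⊢
      · rcases hy with h' | h'
        · exact absurd h' hw
        · exact h'
      · rcases hy' with h' | h'
        · exact absurd h' hw
        · exact h'
    have hwa : w ≠ a := fun e => by rw [e] at hmw; omega
    have hx1 : Equiv.swap a x' w = w :=
      Equiv.swap_apply_of_ne_of_ne hwa (fun e => by rw [e] at hmw; omega)
    have hx2 : Equiv.swap a x w = w :=
      Equiv.swap_apply_of_ne_of_ne hwa (fun e => by rw [e] at hmw; omega)
    rw [hx1, hx2] at hv
    exact hwa hv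
  subst hyy
  rw [Equiv.swap_apply_self] at hv
  -- the `T`-side must cancel
  have hxx : x = x' := by
    by_contra hne
    exact (swap_swap_apply_ne a x x' hne).1 hv
  subst hxx
  simp only [Equiv.swap_mul_self, mul_one] at hrel
  exact ⟨mul_inv_eq_one.mp hrel, rfl, rfl⟩

/-- `1 = (a a)` lies in the middle partner when `a < m`. [folklore] -/
theorem one_mem_swapFamilyT {n m : ℕ} (a : Fin n) (ha : (a : ℕ) < m) :
    (1 : Equiv.Perm (Fin n)) ∈ ((Finset.univ.filter (fun x : Fin n => (x : ℕ) < m)).image (Equiv.swap a)) := by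
  simp only [Finset.mem_image, Finset.mem_filter, Finset.mem_univ, true_and]
  exact ⟨a, ha, Equiv.swap_self a⟩

/-- `1 = (a a)` lies in the right partner. [folklore] -/
theorem one_mem_swapFamilyU {n m : ℕ} (a : Fin n) :
    (1 : Equiv.Perm (Fin n)) ∈ ((Finset.univ.filter (fun x : Fin n => x = a ∨ m ≤ (x : ℕ))).image (Equiv.swap a)) := by
  simp only [Finset.mem_image, Finset.mem_filter, Finset.mem_univ, true_and]
  exact ⟨a, Or.inl rfl, Equiv.swap_self a⟩

/-- **The middle partner is inclusion-saturated w.r.t. `Stab(a)`.**  For `g ∉ T` put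
`y = g⁻¹ a`; then `q = g·(a y)` fixes `a`, and `q⁻¹ · 1⁻¹ · (g (a y)⁻¹) · (1·1⁻¹) = 1` (if `y < m`,
so `(a y) ∈ T`) resp. `q⁻¹ · (g·1⁻¹) · ((a y)·1⁻¹) = 1` (if `y ≥ m`, so `(a y) ∈ U`) is a
non-trivial solution of the TPP relation for `(Stab(a), T ∪ {g}, U)`. [folklore] -/
theorem satMid_swapFamily {n m : ℕ} (a : Fin n) (ha : (a : ℕ) < m) :
    ∀ g ∉ ((Finset.univ.filter (fun x : Fin n => (x : ℕ) < m)).image (Equiv.swap a)),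
      ¬ TripleProductProperty ((Finset.univ.filter (fun σ : Equiv.Perm (Fin n) => σ a = a))) (insert g (((Finset.univ.filter (fun x : Fin n => (x : ℕ) < m)).image (Equiv.swap a))))
        (((Finset.univ.filter (fun x : Fin n => x = a ∨ m ≤ (x : ℕ))).image (Equiv.swap a))) := by
  intro g hg hT
  set y := g⁻¹ a with hy
  have hgy : g y = a := by simp [hy]
  have h1S : (1 : Equiv.Perm (Fin n)) ∈ (Finset.univ.filter (fun σ : Equiv.Perm (Fin n) => σ a = a)) := by simp
  have h1T := one_mem_swapFamilyT a ha
  have h1U := one_mem_swapFamilyU (m := m) a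
  have hq : (g * Equiv.swap a y)⁻¹ ∈ (Finset.univ.filter (fun σ : Equiv.Perm (Fin n) => σ a = a)) := by
    simp only [Finset.mem_filter, Finset.mem_univ, true_and]
    rw [Equiv.Perm.inv_eq_iff_eq, Equiv.Perm.mul_apply, Equiv.swap_apply_left, hgy]
  by_cases hym : (y : ℕ) < m
  · have hyT : Equiv.swap a y ∈ ((Finset.univ.filter (fun x : Fin n => (x : ℕ) < m)).image (Equiv.swap a)) := by
      simp only [Finset.mem_image, Finset.mem_filter, Finset.mem_univ, true_and]
      exact ⟨y, hym, rfl⟩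
    have key := hT _ hq 1 h1S g (Finset.mem_insert_self _ _) (Equiv.swap a y)
      (Finset.mem_insert_of_mem hyT) 1 h1U 1 h1U
      (by simp only [Equiv.swap_inv, inv_one, mul_one, inv_mul_cancel])
    exact hg (key.2.1 ▸ hyT)
  · have hyU : Equiv.swap a y ∈ ((Finset.univ.filter (fun x : Fin n => x = a ∨ m ≤ (x : ℕ))).image (Equiv.swap a)) := by
      simp only [Finset.mem_image, Finset.mem_filter, Finset.mem_univ, true_and]
      exact ⟨y, Or.inr (not_lt.mp hym), rfl⟩
    have key := hT _ hq 1 h1S g (Finset.mem_insert_self _ _) 1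
      (Finset.mem_insert_of_mem h1T) (Equiv.swap a y) hyU 1 h1U
      (by simp only [inv_one, mul_one, mul_assoc, inv_mul_cancel])
    exact hg (key.2.1 ▸ h1T)

/-- **The right partner is inclusion-saturated w.r.t. `Stab(a)`.**  For `g ∉ U` put `y = g⁻¹ a`;
`q = (a y)·g⁻¹` fixes `a`, and `(a y)` sits in `T` (if `y < m`) or in `U` (if `y ≥ m`), giving a
non-trivial solution of the TPP relation for `(Stab(a), T, U ∪ {g})` with `g` in the last slot.
[folklore] -/
theorem satRight_swapFamily {n m : ℕ} (a : Fin n) (ha : (a : ℕ) < m) :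
    ∀ g ∉ ((Finset.univ.filter (fun x : Fin n => x = a ∨ m ≤ (x : ℕ))).image (Equiv.swap a)),
      ¬ TripleProductProperty ((Finset.univ.filter (fun σ : Equiv.Perm (Fin n) => σ a = a))) (((Finset.univ.filter (fun x : Fin n => (x : ℕ) < m)).image (Equiv.swap a)))
        (insert g (((Finset.univ.filter (fun x : Fin n => x = a ∨ m ≤ (x : ℕ))).image (Equiv.swap a)))) := by
  intro g hg hT
  set y := g⁻¹ a with hy
  have h1S : (1 : Equiv.Perm (Fin n)) ∈ (Finset.univ.filter (fun σ : Equiv.Perm (Fin n) => σ a = a)) := by simp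
  have h1T := one_mem_swapFamilyT a ha
  have h1U := one_mem_swapFamilyU (m := m) a
  have hq : (Equiv.swap a y * g⁻¹)⁻¹ ∈ (Finset.univ.filter (fun σ : Equiv.Perm (Fin n) => σ a = a)) := by
    simp only [Finset.mem_filter, Finset.mem_univ, true_and]
    rw [Equiv.Perm.inv_eq_iff_eq, Equiv.Perm.mul_apply, ← hy, Equiv.swap_apply_right]
  by_cases hym : (y : ℕ) < m
  · have hyT : Equiv.swap a y ∈ ((Finset.univ.filter (fun x : Fin n => (x : ℕ) < m)).image (Equiv.swap a)) := by
      simp only [Finset.mem_image, Finset.mem_filter, Finset.mem_univ, true_and]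
      exact ⟨y, hym, rfl⟩
    have key := hT _ hq 1 h1S (Equiv.swap a y) hyT 1 h1T 1 (Finset.mem_insert_of_mem h1U) g
      (Finset.mem_insert_self _ _)
      (by simp only [inv_one, mul_one, one_mul, mul_assoc, inv_mul_cancel])
    exact hg (key.2.2 ▸ h1U)
  · have hyU : Equiv.swap a y ∈ ((Finset.univ.filter (fun x : Fin n => x = a ∨ m ≤ (x : ℕ))).image (Equiv.swap a)) := by
      simp only [Finset.mem_image, Finset.mem_filter, Finset.mem_univ, true_and]
      exact ⟨y, Or.inr (not_lt.mp hym), rfl⟩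
    have key := hT _ hq 1 h1S 1 h1T 1 h1T (Equiv.swap a y) (Finset.mem_insert_of_mem hyU) g
      (Finset.mem_insert_self _ _)
      (by simp only [inv_one, mul_one, inv_mul_cancel])
    exact hg (key.2.2 ▸ hyU)

/-- Atoms of a family of transpositions through `a` with target `a` are single permutations:
`(a x) j = a` forces `x = j`. [folklore] -/
theorem card_atom_swapImage_le_one {n t : ℕ} (A : Finset (Fin n)) (a : Fin n)
    (J : Fin t → Fin n) (k₀ : Fin t) :
    ((A.image (Equiv.swap a)).filter (fun σ => ∀ k, σ (J k) = a)).card ≤ 1 := by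
  refine Finset.card_le_one.mpr (fun σ hσ σ' hσ' => ?_)
  simp only [Finset.mem_filter, Finset.mem_image] at hσ hσ'
  obtain ⟨⟨x, -, rfl⟩, hx⟩ := hσ
  obtain ⟨⟨x', -, rfl⟩, hx'⟩ := hσ'
  have e1 : J k₀ = x := by
    have h := hx k₀
    rwa [Equiv.apply_eq_iff_eq_symm_apply, Equiv.symm_swap, Equiv.swap_apply_left] at h
  have e2 : J k₀ = x' := by
    have h := hx' k₀
    rwa [Equiv.apply_eq_iff_eq_symm_apply, Equiv.symm_swap, Equiv.swap_apply_left] at h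
  rw [← e1, ← e2]

/-- `x ↦ (a x)` is injective (evaluate at `a`). [folklore] -/
theorem swap_left_injective {α : Type*} [DecidableEq α] (a : α) :
    Function.Injective (Equiv.swap a) := by
  intro x y h
  have := congrArg (fun π : Equiv.Perm α => π a) h
  simpa [Equiv.swap_apply_left] using this

/-- `|T| = m` for the middle partner of the level-1 family (`m ≤ n`). [folklore] -/
theorem card_swapFamilyT {n m : ℕ} (a : Fin n) (hmn : m ≤ n) : (((Finset.univ.filter (fun x : Fin n => (x : ℕ) < m)).image (Equiv.swap a))).card = m := by
  rw [Finset.card_image_of_injective _ (swap_left_injective a),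
    Fin.card_filter_val_lt, min_eq_right hmn]

/-- `|U| ≥ n - m` for the right partner of the level-1 family. [folklore] -/
theorem le_card_swapFamilyU {n m : ℕ} (a : Fin n) : n - m ≤ (((Finset.univ.filter (fun x : Fin n => x = a ∨ m ≤ (x : ℕ))).image (Equiv.swap a))).card := by
  rw [Finset.card_image_of_injective _ (swap_left_injective a)]
  have h1 : (Finset.univ.filter (fun x : Fin n => (x : ℕ) < m))ᶜ ⊆
      Finset.univ.filter (fun x : Fin n => x = a ∨ m ≤ (x : ℕ)) := by
    intro x hx
    simp only [Finset.mem_compl, Finset.mem_filter, Finset.mem_univ, true_and, not_lt] at hx ⊢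
    exact Or.inr hx
  have h2 : ((Finset.univ.filter (fun x : Fin n => (x : ℕ) < m))ᶜ).card = n - min n m := by
    rw [Finset.card_compl, Fintype.card_fin, Fin.card_filter_val_lt]
  have h3 : n - m ≤ n - min n m := Nat.sub_le_sub_left (min_le_right n m) n
  exact h3.trans (h2 ▸ Finset.card_le_card h1)

/-- **Exit (b) of `stub_bandRelocation` is false without `Large` (load-bearing analysis).**  The
stub with the largeness hypothesis `(n!)^{3/2}e^{-c√n} ≤ |S||T||U|` deleted and the conclusion
restricted to exit (b) (joint gain at the bumped block itself) fails for `ε = 1/4`, `c = 1` and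
infinitely many `n`: the level-1 family `(Stab(a), {(a x) : x < m}, {(a y) : y = a ∨ y ≥ m})` in
`S_{2m}` is a TPP triple with inclusion-saturated partners (`tpp_swapFamily`, `satMid_swapFamily`,
`satRight_swapFamily`), `S` has the maximal level-1 bump `R_S(a→a) = n > n^{3/4}` (level `1` is
below every band), yet every partner atom with target `a` is a single permutation, so
`|S_a||T_j||U_p| ≤ |S| < e²|S||T||U|/n^{3/2}` (`|T||U| ≥ m² ≥ n^{3/2}/2`).  Hence, at a LOW bump of
`S`, TPP + saturation + the bump do not force any partner isotropy at `S`'s target: exit (b) needs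
the largeness of the triple (here `|S||T||U| ≈ (n-1)!·n²/4 ≪ (n!)^{3/2}`), and exit (a) is what this
family satisfies instead (`T` fixes `n - m` points, so it is super-neutral at every band level).
[folklore] -/
theorem bandRelocation_exitB_false_without_large :
    ¬ (∀ ε : ℝ, 0 < ε → ∀ c : ℝ, 0 < c → ∃ ε' : ℝ, 0 < ε' ∧ ε' ≤ ε ∧ ∃ n₀ : ℕ, ∀ n ≥ n₀,
      ∀ S T U : Finset (Equiv.Perm (Fin n)), TripleProductProperty S T U →
      (∀ g ∉ T, ¬ TripleProductProperty S (insert g T) U) →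
      (∀ g ∉ U, ¬ TripleProductProperty S T (insert g U)) →
      ∀ t : ℕ, 1 ≤ t → (t : ℝ) ≤ Real.sqrt (n : ℝ) →
      ((t : ℝ) < 2 * (n : ℝ) ^ ((1 - ε') / 2) ∨
        c * Real.sqrt (n : ℝ) / (ε' * Real.log (n : ℝ) + 2) < (t : ℝ)) →
      ∀ I L : Fin t → Fin n, Function.Injective I → Function.Injective L →
      (n : ℝ) ^ ((1 / 2 + ε) * t) * (S.card : ℝ) <
        ((S.filter (fun σ => ∀ k, σ (I k) = L k)).card : ℝ) * (n.descFactorial t : ℝ) →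
      ∃ J P : Fin t → Fin n, Function.Injective J ∧ Function.Injective P ∧
        Real.exp (c + 1) * ((S.card * T.card * U.card : ℕ) : ℝ) *
            (((n - t).factorial : ℝ) / (n.factorial : ℝ)) ^ ((3 : ℝ) / 2) ≤
          (((S.filter (fun σ => ∀ k, σ (I k) = L k)).card *
              (T.filter (fun σ => ∀ k, σ (J k) = L k)).card *
              (U.filter (fun σ => ∀ k, σ (P k) = L k)).card : ℕ) : ℝ)) := by
  intro h
  obtain ⟨ε', hε', hε'le, n₀, hn₀⟩ := h (1 / 4) (by norm_num) 1 (by norm_num)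
  -- parameters: m ≥ max(n₀, 2), n = 2m, a = 0
  obtain ⟨m, hm2, hmn₀⟩ : ∃ m : ℕ, 2 ≤ m ∧ n₀ ≤ m := ⟨max n₀ 2, le_max_right _ _, le_max_left _ _⟩
  obtain ⟨n, hn⟩ : ∃ n : ℕ, n = 2 * m := ⟨_, rfl⟩
  have hn₀n : n₀ ≤ n := by omega
  have hmn : m ≤ n := by omega
  have hn1 : 1 ≤ n := by omega
  have hn0 : 0 < n := by omega
  set a : Fin n := ⟨0, hn0⟩ with ha_def
  have ha : (a : ℕ) < m := by rw [ha_def]; dsimp only; omega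
  have hnR1 : (1 : ℝ) ≤ n := by exact_mod_cast hn1
  have hnR : (n : ℝ) = 2 * m := by rw [hn]; push_cast; ring
  have hmR : (2 : ℝ) ≤ m := by exact_mod_cast hm2
  -- the first set and its level-1 block `a ↦ a`
  set S := (Finset.univ.filter (fun σ : Equiv.Perm (Fin n) => σ a = a)) with hS_def
  have h1S : (1 : Equiv.Perm (Fin n)) ∈ S := by simp [hS_def]
  have hSpos : (0 : ℝ) < S.card := by exact_mod_cast Finset.card_pos.mpr ⟨1, h1S⟩
  have hfilt : S.filter (fun σ => ∀ _k : Fin 1, σ a = a) = S := by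
    apply Finset.filter_true_of_mem
    intro σ hσ _
    simpa [hS_def] using hσ
  -- side conditions of the stub at `t = 1`
  have hsqrt : ((1 : ℕ) : ℝ) ≤ Real.sqrt (n : ℝ) := by
    rw [Nat.cast_one]
    exact Real.one_le_sqrt.mpr hnR1
  have hout : ((1 : ℕ) : ℝ) < 2 * (n : ℝ) ^ ((1 - ε') / 2) ∨
      1 * Real.sqrt (n : ℝ) / (ε' * Real.log (n : ℝ) + 2) < ((1 : ℕ) : ℝ) := by
    left
    rw [Nat.cast_one]
    have : (1 : ℝ) ≤ (n : ℝ) ^ ((1 - ε') / 2) := Real.one_le_rpow hnR1 (by linarith)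
    linarith
  have hbump : (n : ℝ) ^ ((1 / 2 + 1 / 4) * ((1 : ℕ) : ℝ)) * (S.card : ℝ) <
      ((S.filter (fun σ => ∀ k : Fin 1, σ ((fun _ => a) k) = (fun _ => a) k)).card : ℝ) *
        (n.descFactorial 1 : ℝ) := by
    rw [show (S.filter (fun σ => ∀ k : Fin 1, σ ((fun _ => a) k) = (fun _ => a) k)) = S from hfilt,
      Nat.descFactorial_one, Nat.cast_one, mul_one]
    have hlt : (n : ℝ) ^ ((1 : ℝ) / 2 + 1 / 4) < (n : ℝ) := by
      have h4 : (1 : ℝ) < n := by linarith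
      calc (n : ℝ) ^ ((1 : ℝ) / 2 + 1 / 4) < (n : ℝ) ^ (1 : ℝ) :=
            Real.rpow_lt_rpow_of_exponent_lt h4 (by norm_num)
        _ = n := Real.rpow_one _
    calc (n : ℝ) ^ ((1 : ℝ) / 2 + 1 / 4) * (S.card : ℝ) < (n : ℝ) * (S.card : ℝ) :=
          mul_lt_mul_of_pos_right hlt hSpos
      _ = (S.card : ℝ) * (n : ℝ) := by ring
  -- apply the statement to the family
  obtain ⟨J, P, -, -, hB⟩ := hn₀ n hn₀n S (((Finset.univ.filter (fun x : Fin n => (x : ℕ) < m)).image (Equiv.swap a))) (((Finset.univ.filter (fun x : Fin n => x = a ∨ m ≤ (x : ℕ))).image (Equiv.swap a)))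
    (tpp_swapFamily a ha) (satMid_swapFamily a ha) (satRight_swapFamily a ha) 1 le_rfl hsqrt hout
    (fun _ => a) (fun _ => a) (Function.injective_of_subsingleton _)
    (Function.injective_of_subsingleton _) hbump
  -- the right-hand side is at most `|S|`
  have hTJ : ((((Finset.univ.filter (fun x : Fin n => (x : ℕ) < m)).image (Equiv.swap a))).filter (fun σ => ∀ k : Fin 1, σ (J k) = (fun _ => a) k)).card ≤ 1 :=
    card_atom_swapImage_le_one _ a J 0
  have hUP : ((((Finset.univ.filter (fun x : Fin n => x = a ∨ m ≤ (x : ℕ))).image (Equiv.swap a))).filter (fun σ => ∀ k : Fin 1, σ (P k) = (fun _ => a) k)).card ≤ 1 :=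
    card_atom_swapImage_le_one _ a P 0
  have hSI : (S.filter (fun σ => ∀ k : Fin 1, σ ((fun _ => a) k) = (fun _ => a) k)).card ≤ S.card :=
    Finset.card_le_card (Finset.filter_subset _ _)
  have hRHS : (((S.filter (fun σ => ∀ k : Fin 1, σ ((fun _ => a) k) = (fun _ => a) k)).card *
      ((((Finset.univ.filter (fun x : Fin n => (x : ℕ) < m)).image (Equiv.swap a))).filter (fun σ => ∀ k : Fin 1, σ (J k) = (fun _ => a) k)).card *
      ((((Finset.univ.filter (fun x : Fin n => x = a ∨ m ≤ (x : ℕ))).image (Equiv.swap a))).filter (fun σ => ∀ k : Fin 1, σ (P k) = (fun _ => a) k)).card : ℕ) : ℝ)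
      ≤ (S.card : ℝ) := by
    have h1 := Nat.mul_le_mul (Nat.mul_le_mul hSI hTJ) hUP
    rw [mul_one, mul_one] at h1
    exact_mod_cast h1
  -- the left-hand side: volume and the factor `((n-1)!/n!)^{3/2} = (n√n)⁻¹`
  have hT : (((Finset.univ.filter (fun x : Fin n => (x : ℕ) < m)).image (Equiv.swap a))).card = m := card_swapFamilyT a hmn
  have hU : m ≤ (((Finset.univ.filter (fun x : Fin n => x = a ∨ m ≤ (x : ℕ))).image (Equiv.swap a))).card := by
    have := le_card_swapFamilyU (m := m) a
    omega
  have hvol : (S.card : ℝ) * ((m : ℝ) * m) ≤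
      ((S.card * (((Finset.univ.filter (fun x : Fin n => (x : ℕ) < m)).image (Equiv.swap a))).card * (((Finset.univ.filter (fun x : Fin n => x = a ∨ m ≤ (x : ℕ))).image (Equiv.swap a))).card : ℕ) : ℝ) := by
    have h1 : S.card * (m * m) ≤ S.card * (((Finset.univ.filter (fun x : Fin n => (x : ℕ) < m)).image (Equiv.swap a))).card * (((Finset.univ.filter (fun x : Fin n => x = a ∨ m ≤ (x : ℕ))).image (Equiv.swap a))).card := by
      rw [hT, mul_assoc]
      exact Nat.mul_le_mul_left _ (Nat.mul_le_mul_left _ hU)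
    exact_mod_cast h1
  have hratio : ((((n - 1).factorial : ℕ) : ℝ) / (n.factorial : ℝ)) ^ ((3 : ℝ) / 2) =
      ((n : ℝ) * Real.sqrt n)⁻¹ := by
    have hf : (n.factorial : ℝ) = n * ((n - 1).factorial : ℝ) := by
      exact_mod_cast (Nat.mul_factorial_pred (by omega : n ≠ 0)).symm
    have hf0 : (0 : ℝ) < ((n - 1).factorial : ℝ) := by exact_mod_cast Nat.factorial_pos _
    have hn0R : (0 : ℝ) < n := by linarith
    rw [hf, show (((n - 1).factorial : ℕ) : ℝ) / ((n : ℝ) * ((n - 1).factorial : ℝ)) = (n : ℝ)⁻¹ by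
      field_simp]
    rw [Real.inv_rpow hn0R.le, show (3 : ℝ) / 2 = 1 + 1 / 2 by norm_num,
      Real.rpow_add hn0R, Real.rpow_one, Real.sqrt_eq_rpow]
  -- n√n ≤ 2m²
  have hsq : Real.sqrt (n : ℝ) ≤ m := by
    rw [Real.sqrt_le_left (by positivity), hnR]
    nlinarith
  have hnsn : (n : ℝ) * Real.sqrt n ≤ 2 * ((m : ℝ) * m) := by
    calc (n : ℝ) * Real.sqrt n ≤ (n : ℝ) * m := mul_le_mul_of_nonneg_left hsq (by positivity)
      _ = 2 * ((m : ℝ) * m) := by rw [hnR]; ring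
  -- combine: e² · |S| m² ≤ |S| · n√n ≤ 2 |S| m²
  have hpos : (0 : ℝ) < (n : ℝ) * Real.sqrt n := by
    have : (0 : ℝ) < Real.sqrt n := Real.sqrt_pos.mpr (by linarith)
    positivity
  rw [hratio] at hB
  have hB' : Real.exp (1 + 1) * ((S.card : ℝ) * ((m : ℝ) * m)) ≤ (S.card : ℝ) * ((n : ℝ) * Real.sqrt n) := by
    have h1 := le_trans hB hRHS
    rw [← div_eq_mul_inv, div_le_iff₀ hpos] at h1
    refine le_trans ?_ h1
    exact mul_le_mul_of_nonneg_left hvol (Real.exp_pos _).le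
  have he : (3 : ℝ) < Real.exp (1 + 1) := by
    have := Real.add_one_lt_exp (show (1 + 1 : ℝ) ≠ 0 by norm_num)
    linarith
  have hmm : (0 : ℝ) < (S.card : ℝ) * ((m : ℝ) * m) := by positivity
  nlinarith [mul_le_mul_of_nonneg_left hnsn hSpos.le]
end Summit.MatrixMultiplication.MatrixMultiplication.Theorems.JuntaBranch
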